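import Summits.CriticalPhenomena.PercolationContinuityZ3.Theorems.PercNearOneGluingNoHeavyQuantFarGate3Assembly
import Summits.CriticalPhenomena.PercolationContinuityZ3.Theorems.PercNearOneGluingNoHeavyQuantFarGate3Items
import HarnessLib

/-!
# QUANT lane R8, front "FAR beyond trees", layer one — THE DEGREE-THREE GATE AT THE OBSERVER, XVII: the generalized item (engine) and the band

builds on p205010 (kernel theorem, internal audit signed; external expert review pending)

Support file (`--supports stmt-CriticalPhenomena-4575`), seat `prim-quant-p1` (gen 28); memo
`run/shared/lean/prim/quant/prim-quant-p1-g28/FOR-LEAD-GATE3.md` §6c.  Standard axioms; no sorries; no definitions.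

**The generalized item and the band.**  Every Harris-free certificate of the cover lemma is ONE generalized item (memo §5): a
price `π` (multiplier of `S ≤ Σ sub·x`), a mean weight `0 ≤ μ ≤ π`, outside weight `n(π−μ)` and cut weights `λ_v, λ₁, λ₂` summing to one;
constant-weight combinations of menu items are dominated by a single generalized item because `F(π;M)` is concave in `π`.
`Gate3.arith_item` is that engine in the cover-lemma format (files XV, XVI are the instances `μ = π, λ_v = 1` and `μ = 0, λ₂ = 1 − nπ`);
`Gate3.arith_item_agg` the aggregate form and `Gate3.of_weighted₃` the sign-case step of the HARRIS ENGINE (a certificate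
`Σ_j w_j(x)·G_j(x) = Σ_k ν_k·Harris_k(x) + σ(x)` then proves the row by three applications of `arith_item_agg`).
`Gate3.arith_band` instantiates it at a price `π ∈ [ρ₀, ρ₃]` with the type values `(φ₀₁−π sub₀₁, φ₁₀−π sub₁₀, φ₂₀−π sub₂₀, φ₃₀−π sub₃₀, 1−nπ)`
and WITNESS weights; `Quant.farLayerOne_of_gate3_band` is the row.  Numerically (`num3/band2–5.py`, exact LP) witnesses exist at `π = ρ₃` or
`π = ρ₀` on ALL 2 451 grid points of the wild band left open by the closed-form regimes XIV–XVI; what then remains of the general gate is the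
HARRIS band only (`p < 1/2`, large `r̄ < r*(p)`; 2 030 grid points), where the three union rows are needed (memo §7).
-/

noncomputable section

namespace Summit.CriticalPhenomena.PercolationContinuityZ3.Theorems

namespace Quant

open Finset MeasureTheory Set
open Literature.Probability.LatticeModels
open Literature.Probability.Percolation
open Bundle (offZ)
open scoped Classical

namespace Gate3

/-- **The generalized item, aggregate form** (engine; memo §5): as `arith_item` below but with the single type-level hypothesis
`G(x) = Σ_T M_T·g_T ≥ 0` evaluated at the cells — the form needed under Harris, where only a weighted sum of items is non-negative.
Original docstring of the coefficientwise form: a price `π`, a mean weight `0 ≤ μ ≤ π` (outside weight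
`λ_S = n(π − μ)`), cut weights `λ_v, λ₁, λ₂ ≥ 0` with `λ_v + λ₁ + λ₂ + n(π−μ) = 1`, type values `t_T` below every cell entry `φ − π·sub` (file XII),
and the five type conditions `t_T − Σᵢ λᵢ ψ_(i,T) + μ(2 − Ψ_T) ≥ 0` give the row.  Families A (`μ = 0`), B (`μ = π`), C of the menu and the items
of files XIV–XVI are instances. [this work] -/
theorem arith_item_agg (p r₁ r₂ nn π μ lv l1 l2 t0 t1 t2 t3 t4 : ℝ) (hμ0 : 0 ≤ μ) (hμπ : μ ≤ π)
    (hlv : 0 ≤ lv) (hl1 : 0 ≤ l1) (hl2 : 0 ≤ l2) (hsl : lv + l1 + l2 + nn * (π - μ) = 1)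
    (hta0 : t0 ≤ p * (1 - (1 - r₁) * (1 - r₂)) - π * (p * max r₁ r₂ * nn))
    (hta1 : t0 ≤ p - π * ((1 + p * max r₁ r₂ * (nn - 1))))
    (hta2 : t0 ≤ 1 - π * (nn))
    (htb₁0 : t1 ≤ (1 - (1 - p) * (1 - r₁)) - π * ((1 - (1 - p) * (1 - r₁)) * r₂ * nn))
    (htb₁1 : t1 ≤ 1 - π * ((1 + (1 - (1 - p) * (1 - r₁)) * r₂ * (nn - 1))))
    (htb₁2 : t1 ≤ 1 - π * (nn))
    (htb₂0 : t2 ≤ (1 - (1 - p) * (1 - r₂)) - π * ((1 - (1 - p) * (1 - r₂)) * r₁ * nn))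
    (htb₂1 : t2 ≤ 1 - π * ((1 + (1 - (1 - p) * (1 - r₂)) * r₁ * (nn - 1))))
    (htb₂2 : t2 ≤ 1 - π * (nn))
    (htc0 : t3 ≤ p * (1 - (1 - r₁) * (1 - r₂)) - π * (p * (1 - (1 - r₁) * (1 - r₂)) * nn))
    (htc1 : t3 ≤ p - π * ((1 + p * (1 - (1 - r₁) * (1 - r₂)) * (nn - 1))))
    (htc2 : t3 ≤ 1 - π * (nn))
    (htd0 : t4 ≤ 1 - π * (0 * nn))
    (htd1 : t4 ≤ 1 - π * ((1 + 0 * (nn - 1))))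
    (htd2 : t4 ≤ 1 - π * (nn))
    (t S a0 a1 a2 b10 b11 b12 b20 b21 b22 c0 c1 c2 d0 d1 d2 : ℝ)
    (hna0 : 0 ≤ a0)
    (hna1 : 0 ≤ a1)
    (hna2 : 0 ≤ a2)
    (hnb10 : 0 ≤ b10)
    (hnb11 : 0 ≤ b11)
    (hnb12 : 0 ≤ b12)
    (hnb20 : 0 ≤ b20)
    (hnb21 : 0 ≤ b21)
    (hnb22 : 0 ≤ b22)
    (hnc0 : 0 ≤ c0)
    (hnc1 : 0 ≤ c1)
    (hnc2 : 0 ≤ c2)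
    (hnd0 : 0 ≤ d0)
    (hnd1 : 0 ≤ d1)
    (hnd2 : 0 ≤ d2)
    (hsum : a0 + a1 + a2 + b10 + b11 + b12 + b20 + b21 + b22 + c0 + c1 + c2 + d0 + d1 + d2 = 1)
    (_hH1 : ((a0 + a1 + a2) + (c0 + c1 + c2) + (b20 + b21 + b22)) * ((a0 + a1 + a2) + (b10 + b11 + b12)) ≤ (a0 + a1 + a2))
    (_hH2 : ((a0 + a1 + a2) + (c0 + c1 + c2) + (b10 + b11 + b12)) * ((a0 + a1 + a2) + (b20 + b21 + b22)) ≤ (a0 + a1 + a2))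
    (_hH3 : ((a0 + a1 + a2) + (b10 + b11 + b12) + (b20 + b21 + b22)) * ((a0 + a1 + a2) + (c0 + c1 + c2)) ≤ (a0 + a1 + a2))
    (hcv : (1 - p) * (r₁ * r₂) * ((a0 + a1 + a2) + (c0 + c1 + c2)) + (1 - p) * (r₁ * (1 - r₂)) * ((a0 + a1 + a2) + (c0 + c1 + c2) + (b20 + b21 + b22)) + (1 - p) * ((1 - r₁) * r₂) * ((a0 + a1 + a2) + (c0 + c1 + c2) + (b10 + b11 + b12)) + (1 - p) * ((1 - r₁) * (1 - r₂)) ≤ t)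
    (hc1 : p * ((1 - r₁) * r₂) * ((a0 + a1 + a2) + (b20 + b21 + b22)) + (1 - p) * (r₁ * r₂) * ((a0 + a1 + a2) + (c0 + c1 + c2)) + (p * ((1 - r₁) * (1 - r₂)) + (1 - p) * (r₁ * (1 - r₂)) + (1 - p) * ((1 - r₁) * r₂) + (1 - p) * ((1 - r₁) * (1 - r₂))) * ((a0 + a1 + a2) + (c0 + c1 + c2) + (b20 + b21 + b22)) ≤ t)
    (hc2 : p * ((1 - r₂) * r₁) * ((a0 + a1 + a2) + (b10 + b11 + b12)) + (1 - p) * (r₂ * r₁) * ((a0 + a1 + a2) + (c0 + c1 + c2)) + (p * ((1 - r₂) * (1 - r₁)) + (1 - p) * (r₂ * (1 - r₁)) + (1 - p) * ((1 - r₂) * r₁) + (1 - p) * ((1 - r₂) * (1 - r₁))) * ((a0 + a1 + a2) + (c0 + c1 + c2) + (b10 + b11 + b12)) ≤ t)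
    (hout : nn - S ≤ nn * t)
    (hsub : S ≤ (p * max r₁ r₂ * nn * a0 + (1 + p * max r₁ r₂ * (nn - 1)) * a1 + nn * a2) + ((1 - (1 - p) * (1 - r₁)) * r₂ * nn * b10 + (1 + (1 - (1 - p) * (1 - r₁)) * r₂ * (nn - 1)) * b11 + nn * b12) + ((1 - (1 - p) * (1 - r₂)) * r₁ * nn * b20 + (1 + (1 - (1 - p) * (1 - r₂)) * r₁ * (nn - 1)) * b21 + nn * b22) + (p * (1 - (1 - r₁) * (1 - r₂)) * nn * c0 + (1 + p * (1 - (1 - r₁) * (1 - r₂)) * (nn - 1)) * c1 + nn * c2) + ((1 : ℝ) * d1 + nn * d2))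
    (hmean : 2 < (1 - ((1 - p) * (r₁ * r₂) * ((a0 + a1 + a2) + (c0 + c1 + c2)) + (1 - p) * (r₁ * (1 - r₂)) * ((a0 + a1 + a2) + (c0 + c1 + c2) + (b20 + b21 + b22)) + (1 - p) * ((1 - r₁) * r₂) * ((a0 + a1 + a2) + (c0 + c1 + c2) + (b10 + b11 + b12)) + (1 - p) * ((1 - r₁) * (1 - r₂)))) + (1 - (p * ((1 - r₁) * r₂) * ((a0 + a1 + a2) + (b20 + b21 + b22)) + (1 - p) * (r₁ * r₂) * ((a0 + a1 + a2) + (c0 + c1 + c2)) + (p * ((1 - r₁) * (1 - r₂)) + (1 - p) * (r₁ * (1 - r₂)) + (1 - p) * ((1 - r₁) * r₂) + (1 - p) * ((1 - r₁) * (1 - r₂))) * ((a0 + a1 + a2) + (c0 + c1 + c2) + (b20 + b21 + b22)))) + (1 - (p * ((1 - r₂) * r₁) * ((a0 + a1 + a2) + (b10 + b11 + b12)) + (1 - p) * (r₂ * r₁) * ((a0 + a1 + a2) + (c0 + c1 + c2)) + (p * ((1 - r₂) * (1 - r₁)) + (1 - p) * (r₂ * (1 - r₁)) + (1 - p) * ((1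 - r₂) * r₁) + (1 - p) * ((1 - r₂) * (1 - r₁))) * ((a0 + a1 + a2) + (c0 + c1 + c2) + (b10 + b11 + b12)))) + S)
    (hG : 0 ≤ (a0 + a1 + a2) * (t0 - lv * p - l1 * (p * r₁) - l2 * (p * r₂) + μ * (2 - (p + (p * r₁) + (p * r₂)))) +
      (b10 + b11 + b12) * (t1 - lv * (1 - (1 - p) * (1 - r₁)) - l1 * 1 - l2 * (r₂ * (1 - (1 - p) * (1 - r₁))) + μ * (2 - ((1 - (1 - p) * (1 - r₁)) + 1 + (r₂ * (1 - (1 - p) * (1 - r₁)))))) +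
      (b20 + b21 + b22) * (t2 - lv * (1 - (1 - p) * (1 - r₂)) - l1 * (r₁ * (1 - (1 - p) * (1 - r₂))) - l2 * 1 + μ * (2 - ((1 - (1 - p) * (1 - r₂)) + (r₁ * (1 - (1 - p) * (1 - r₂))) + 1))) +
      (c0 + c1 + c2) * (t3 - lv * p - l1 * (p * (1 - (1 - r₁) * (1 - r₂))) - l2 * (p * (1 - (1 - r₁) * (1 - r₂))) + μ * (2 - (p + (p * (1 - (1 - r₁) * (1 - r₂))) + (p * (1 - (1 - r₁) * (1 - r₂)))))) +
      (d0 + d1 + d2) * (t4 - lv * (1 - (1 - p) * ((1 - r₁) * (1 - r₂))) - l1 * 1 - l2 * 1 + μ * (2 - ((1 - (1 - p) * ((1 - r₁) * (1 - r₂))) + 1 + 1)))) :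
    p * ((1 - r₁) * (1 - r₂)) * (a0 + c0) + (1 - p) * (r₁ * r₂) * (a0 + a1 + c0 + c1) + (1 - p) * (r₁ * (1 - r₂)) * (a0 + a1 + c0 + c1 + b20) + (1 - p) * ((1 - r₁) * r₂) * (a0 + a1 + c0 + c1 + b10) + (1 - p) * ((1 - r₁) * (1 - r₂)) * (a0 + a1 + c0 + c1 + b10 + b20) ≤ t := by
  have hπ0 : 0 ≤ π := le_trans hμ0 hμπ
  have hcl := cells_lower p r₁ r₂ nn π t0 t1 t2 t3 t4 a0 a1 a2 b10 b11 b12 b20 b21 b22 c0 c1 c2 d0 d1 d2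
    hna0 hna1 hna2 hnb10 hnb11 hnb12 hnb20 hnb21 hnb22 hnc0 hnc1 hnc2 hnd0 hnd1 hnd2
    hta0 hta1 hta2 htb₁0 htb₁1 htb₁2 htb₂0 htb₂1 htb₂2 htc0 htc1 htc2 htd0 htd1 htd2
  have hπs := mul_le_mul_of_nonneg_left hsub hπ0
  have hμm : 0 ≤ μ * ((1 - ((1 - p) * (r₁ * r₂) * ((a0 + a1 + a2) + (c0 + c1 + c2)) + (1 - p) * (r₁ * (1 - r₂)) * ((a0 + a1 + a2) + (c0 + c1 + c2) + (b20 + b21 + b22)) + (1 - p) * ((1 - r₁) * r₂) * ((a0 + a1 + a2) + (c0 + c1 + c2) + (b10 + b11 + b12)) + (1 - p) * ((1 - r₁) * (1 - r₂)))) + (1 - (p * ((1 - r₁) * r₂) * ((a0 + a1 + a2) + (b20 + b21 + b22)) + (1 - p) * (r₁ * r₂) * ((a0 + a1 + a2) + (c0 + c1 + c2)) + (p * ((1 - r₁) * (1 - r₂)) + (1 - p) * (r₁ * (1 - r₂)) + (1 - p) * ((1 - r₁) * r₂) + (1 - p) * ((1 - r₁) * (1 - r₂))) * ((a0 + a1 +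 a2) + (c0 + c1 + c2) + (b20 + b21 + b22)))) + (1 - (p * ((1 - r₂) * r₁) * ((a0 + a1 + a2) + (b10 + b11 + b12)) + (1 - p) * (r₂ * r₁) * ((a0 + a1 + a2) + (c0 + c1 + c2)) + (p * ((1 - r₂) * (1 - r₁)) + (1 - p) * (r₂ * (1 - r₁)) + (1 - p) * ((1 - r₂) * r₁) + (1 - p) * ((1 - r₂) * (1 - r₁))) * ((a0 + a1 + a2) + (c0 + c1 + c2) + (b10 + b11 + b12)))) + S - 2) :=
    mul_nonneg hμ0 (by linarith only [hmean])
  have hSo : 0 ≤ (π - μ) * (nn * t - (nn - S)) := mul_nonneg (sub_nonneg.2 hμπ) (by linarith only [hout])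
  have hqv : 0 ≤ lv * (t - ((1 - p) * (r₁ * r₂) * ((a0 + a1 + a2) + (c0 + c1 + c2)) + (1 - p) * (r₁ * (1 - r₂)) * ((a0 + a1 + a2) + (c0 + c1 + c2) + (b20 + b21 + b22)) + (1 - p) * ((1 - r₁) * r₂) * ((a0 + a1 + a2) + (c0 + c1 + c2) + (b10 + b11 + b12)) + (1 - p) * ((1 - r₁) * (1 - r₂)))) := mul_nonneg hlv (by linarith only [hcv])
  have hq1 : 0 ≤ l1 * (t - (p * ((1 - r₁) * r₂) * ((a0 + a1 + a2) + (b20 + b21 + b22)) + (1 - p) * (r₁ * r₂) * ((a0 + a1 + a2) + (c0 + c1 + c2)) + (p * ((1 - r₁) * (1 - r₂)) + (1 - p) * (r₁ * (1 - r₂)) + (1 - p) * ((1 - r₁) * r₂) + (1 - p) * ((1 - r₁) * (1 - r₂))) * ((a0 + a1 + a2) + (c0 + c1 + c2) + (b20 + b21 + b22)))) := mul_nonneg hl1 (by linarith only [hc1])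
  have hq2 : 0 ≤ l2 * (t - (p * ((1 - r₂) * r₁) * ((a0 + a1 + a2) + (b10 + b11 + b12)) + (1 - p) * (r₂ * r₁) * ((a0 + a1 + a2) + (c0 + c1 + c2)) + (p * ((1 - r₂) * (1 - r₁)) + (1 - p) * (r₂ * (1 - r₁)) + (1 - p) * ((1 - r₂) * r₁) + (1 - p) * ((1 - r₂) * (1 - r₁))) * ((a0 + a1 + a2) + (c0 + c1 + c2) + (b10 + b11 + b12)))) := mul_nonneg hl2 (by linarith only [hc2])
  have eWv : lv * ((1 - p) * ((1 - r₁) * (1 - r₂))) * (a0 + a1 + a2 + b10 + b11 + b12 + b20 + b21 + b22 + c0 + c1 + c2 + d0 + d1 + d2) = lv * ((1 - p) * ((1 - r₁) * (1 - r₂))) := by rw [hsum, mul_one]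
  have eWμ : μ * ((1 - p) * ((1 - r₁) * (1 - r₂))) * (a0 + a1 + a2 + b10 + b11 + b12 + b20 + b21 + b22 + c0 + c1 + c2 + d0 + d1 + d2) = μ * ((1 - p) * ((1 - r₁) * (1 - r₂))) := by rw [hsum, mul_one]
  have eμ : μ * (a0 + a1 + a2 + b10 + b11 + b12 + b20 + b21 + b22 + c0 + c1 + c2 + d0 + d1 + d2) = μ := by rw [hsum, mul_one]
  have et : (lv + l1 + l2 + nn * (π - μ)) * t = t := by rw [hsl, one_mul]
  have elv : lv * (a0 + a1 + a2 + b10 + b11 + b12 + b20 + b21 + b22 + c0 + c1 + c2 + d0 + d1 + d2) = lv := by rw [hsum, mul_one]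
  have el1 : l1 * (a0 + a1 + a2 + b10 + b11 + b12 + b20 + b21 + b22 + c0 + c1 + c2 + d0 + d1 + d2) = l1 := by rw [hsum, mul_one]
  have el2 : l2 * (a0 + a1 + a2 + b10 + b11 + b12 + b20 + b21 + b22 + c0 + c1 + c2 + d0 + d1 + d2) = l2 := by rw [hsum, mul_one]
  linarith only [hcl, hG, hπs, hμm, hSo, hqv, hq1, hq2, eWv, eWμ, eμ, et, elv, el1, el2, hsum, hsl]

/-- **The generalized item** (engine of every Harris-free certificate; memo §5): a price `π`, a mean weight `0 ≤ μ ≤ π` (outside weight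
`λ_S = n(π − μ)`), cut weights `λ_v, λ₁, λ₂ ≥ 0` with `λ_v + λ₁ + λ₂ + n(π−μ) = 1`, type values `t_T` below every cell entry `φ − π·sub` (file XII),
and the five type conditions `t_T − Σᵢ λᵢ ψ_(i,T) + μ(2 − Ψ_T) ≥ 0` give the row.  Families A (`μ = 0`), B (`μ = π`), C of the menu and the items
of files XIV–XVI are instances. [this work] -/
theorem arith_item (p r₁ r₂ nn π μ lv l1 l2 t0 t1 t2 t3 t4 : ℝ) (hμ0 : 0 ≤ μ) (hμπ : μ ≤ π)
    (hlv : 0 ≤ lv) (hl1 : 0 ≤ l1) (hl2 : 0 ≤ l2) (hsl : lv + l1 + l2 + nn * (π - μ) = 1)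
    (hta0 : t0 ≤ p * (1 - (1 - r₁) * (1 - r₂)) - π * (p * max r₁ r₂ * nn))
    (hta1 : t0 ≤ p - π * ((1 + p * max r₁ r₂ * (nn - 1))))
    (hta2 : t0 ≤ 1 - π * (nn))
    (htb₁0 : t1 ≤ (1 - (1 - p) * (1 - r₁)) - π * ((1 - (1 - p) * (1 - r₁)) * r₂ * nn))
    (htb₁1 : t1 ≤ 1 - π * ((1 + (1 - (1 - p) * (1 - r₁)) * r₂ * (nn - 1))))
    (htb₁2 : t1 ≤ 1 - π * (nn))
    (htb₂0 : t2 ≤ (1 - (1 - p) * (1 - r₂)) - π * ((1 - (1 - p) * (1 - r₂)) * r₁ * nn))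
    (htb₂1 : t2 ≤ 1 - π * ((1 + (1 - (1 - p) * (1 - r₂)) * r₁ * (nn - 1))))
    (htb₂2 : t2 ≤ 1 - π * (nn))
    (htc0 : t3 ≤ p * (1 - (1 - r₁) * (1 - r₂)) - π * (p * (1 - (1 - r₁) * (1 - r₂)) * nn))
    (htc1 : t3 ≤ p - π * ((1 + p * (1 - (1 - r₁) * (1 - r₂)) * (nn - 1))))
    (htc2 : t3 ≤ 1 - π * (nn))
    (htd0 : t4 ≤ 1 - π * (0 * nn))
    (htd1 : t4 ≤ 1 - π * ((1 + 0 * (nn - 1))))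
    (htd2 : t4 ≤ 1 - π * (nn))
    (hg0 : 0 ≤ t0 - lv * p - l1 * (p * r₁) - l2 * (p * r₂) + μ * (2 - (p + (p * r₁) + (p * r₂))))
    (hg1 : 0 ≤ t1 - lv * (1 - (1 - p) * (1 - r₁)) - l1 * 1 - l2 * (r₂ * (1 - (1 - p) * (1 - r₁))) + μ * (2 - ((1 - (1 - p) * (1 - r₁)) + 1 + (r₂ * (1 - (1 - p) * (1 - r₁))))))
    (hg2 : 0 ≤ t2 - lv * (1 - (1 - p) * (1 - r₂)) - l1 * (r₁ * (1 - (1 - p) * (1 - r₂))) - l2 * 1 + μ * (2 - ((1 - (1 - p) * (1 - r₂)) + (r₁ * (1 - (1 - p) * (1 - r₂))) + 1)))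
    (hg3 : 0 ≤ t3 - lv * p - l1 * (p * (1 - (1 - r₁) * (1 - r₂))) - l2 * (p * (1 - (1 - r₁) * (1 - r₂))) + μ * (2 - (p + (p * (1 - (1 - r₁) * (1 - r₂))) + (p * (1 - (1 - r₁) * (1 - r₂))))))
    (hg4 : 0 ≤ t4 - lv * (1 - (1 - p) * ((1 - r₁) * (1 - r₂))) - l1 * 1 - l2 * 1 + μ * (2 - ((1 - (1 - p) * ((1 - r₁) * (1 - r₂))) + 1 + 1)))
    (t S a0 a1 a2 b10 b11 b12 b20 b21 b22 c0 c1 c2 d0 d1 d2 : ℝ)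
    (hna0 : 0 ≤ a0)
    (hna1 : 0 ≤ a1)
    (hna2 : 0 ≤ a2)
    (hnb10 : 0 ≤ b10)
    (hnb11 : 0 ≤ b11)
    (hnb12 : 0 ≤ b12)
    (hnb20 : 0 ≤ b20)
    (hnb21 : 0 ≤ b21)
    (hnb22 : 0 ≤ b22)
    (hnc0 : 0 ≤ c0)
    (hnc1 : 0 ≤ c1)
    (hnc2 : 0 ≤ c2)
    (hnd0 : 0 ≤ d0)
    (hnd1 : 0 ≤ d1)
    (hnd2 : 0 ≤ d2)
    (hsum : a0 + a1 + a2 + b10 + b11 + b12 + b20 + b21 + b22 + c0 + c1 + c2 + d0 + d1 + d2 = 1)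
    (_hH1 : ((a0 + a1 + a2) + (c0 + c1 + c2) + (b20 + b21 + b22)) * ((a0 + a1 + a2) + (b10 + b11 + b12)) ≤ (a0 + a1 + a2))
    (_hH2 : ((a0 + a1 + a2) + (c0 + c1 + c2) + (b10 + b11 + b12)) * ((a0 + a1 + a2) + (b20 + b21 + b22)) ≤ (a0 + a1 + a2))
    (_hH3 : ((a0 + a1 + a2) + (b10 + b11 + b12) + (b20 + b21 + b22)) * ((a0 + a1 + a2) + (c0 + c1 + c2)) ≤ (a0 + a1 + a2))
    (hcv : (1 - p) * (r₁ * r₂) * ((a0 + a1 + a2) + (c0 + c1 + c2)) + (1 - p) * (r₁ * (1 - r₂)) * ((a0 + a1 + a2) + (c0 + c1 + c2) + (b20 + b21 + b22)) + (1 - p) * ((1 - r₁) * r₂) * ((a0 + a1 + a2) + (c0 + c1 + c2) + (b10 + b11 + b12)) + (1 - p) * ((1 - r₁) * (1 - r₂)) ≤ t)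
    (hc1 : p * ((1 - r₁) * r₂) * ((a0 + a1 + a2) + (b20 + b21 + b22)) + (1 - p) * (r₁ * r₂) * ((a0 + a1 + a2) + (c0 + c1 + c2)) + (p * ((1 - r₁) * (1 - r₂)) + (1 - p) * (r₁ * (1 - r₂)) + (1 - p) * ((1 - r₁) * r₂) + (1 - p) * ((1 - r₁) * (1 - r₂))) * ((a0 + a1 + a2) + (c0 + c1 + c2) + (b20 + b21 + b22)) ≤ t)
    (hc2 : p * ((1 - r₂) * r₁) * ((a0 + a1 + a2) + (b10 + b11 + b12)) + (1 - p) * (r₂ * r₁) * ((a0 + a1 + a2) + (c0 + c1 + c2)) + (p * ((1 - r₂) * (1 - r₁)) + (1 - p) * (r₂ * (1 - r₁)) + (1 - p) * ((1 - r₂) * r₁) + (1 - p) * ((1 - r₂) * (1 - r₁))) * ((a0 + a1 + a2) + (c0 + c1 + c2) + (b10 + b11 + b12)) ≤ t)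
    (hout : nn - S ≤ nn * t)
    (hsub : S ≤ (p * max r₁ r₂ * nn * a0 + (1 + p * max r₁ r₂ * (nn - 1)) * a1 + nn * a2) + ((1 - (1 - p) * (1 - r₁)) * r₂ * nn * b10 + (1 + (1 - (1 - p) * (1 - r₁)) * r₂ * (nn - 1)) * b11 + nn * b12) + ((1 - (1 - p) * (1 - r₂)) * r₁ * nn * b20 + (1 + (1 - (1 - p) * (1 - r₂)) * r₁ * (nn - 1)) * b21 + nn * b22) + (p * (1 - (1 - r₁) * (1 - r₂)) * nn * c0 + (1 + p * (1 - (1 - r₁) * (1 - r₂)) * (nn - 1)) * c1 + nn * c2) + ((1 : ℝ) * d1 + nn * d2))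
    (hmean : 2 < (1 - ((1 - p) * (r₁ * r₂) * ((a0 + a1 + a2) + (c0 + c1 + c2)) + (1 - p) * (r₁ * (1 - r₂)) * ((a0 + a1 + a2) + (c0 + c1 + c2) + (b20 + b21 + b22)) + (1 - p) * ((1 - r₁) * r₂) * ((a0 + a1 + a2) + (c0 + c1 + c2) + (b10 + b11 + b12)) + (1 - p) * ((1 - r₁) * (1 - r₂)))) + (1 - (p * ((1 - r₁) * r₂) * ((a0 + a1 + a2) + (b20 + b21 + b22)) + (1 - p) * (r₁ * r₂) * ((a0 + a1 + a2) + (c0 + c1 + c2)) + (p * ((1 - r₁) * (1 - r₂)) + (1 - p) * (r₁ * (1 - r₂)) + (1 - p) * ((1 - r₁) * r₂) + (1 - p) * ((1 - r₁) * (1 - r₂))) * ((a0 + a1 + a2) + (c0 + c1 + c2) + (b20 + b21 + b22)))) + (1 - (p * ((1 - r₂) * r₁) * ((a0 + a1 + a2) + (b10 + b11 + b12)) + (1 - p) * (r₂ * r₁) * ((a0 + a1 + a2) + (c0 + c1 + c2)) + (p * ((1 - r₂) * (1 - r₁)) + (1 - p) * (r₂ * (1 - r₁)) + (1 - p) * ((1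 - r₂) * r₁) + (1 - p) * ((1 - r₂) * (1 - r₁))) * ((a0 + a1 + a2) + (c0 + c1 + c2) + (b10 + b11 + b12)))) + S) :
    p * ((1 - r₁) * (1 - r₂)) * (a0 + c0) + (1 - p) * (r₁ * r₂) * (a0 + a1 + c0 + c1) + (1 - p) * (r₁ * (1 - r₂)) * (a0 + a1 + c0 + c1 + b20) + (1 - p) * ((1 - r₁) * r₂) * (a0 + a1 + c0 + c1 + b10) + (1 - p) * ((1 - r₁) * (1 - r₂)) * (a0 + a1 + c0 + c1 + b10 + b20) ≤ t := by
  have hMa : 0 ≤ a0 + a1 + a2 := by linarith only [hna0, hna1, hna2]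
  have hMb1 : 0 ≤ b10 + b11 + b12 := by linarith only [hnb10, hnb11, hnb12]
  have hMb2 : 0 ≤ b20 + b21 + b22 := by linarith only [hnb20, hnb21, hnb22]
  have hMc : 0 ≤ c0 + c1 + c2 := by linarith only [hnc0, hnc1, hnc2]
  have hMd : 0 ≤ d0 + d1 + d2 := by linarith only [hnd0, hnd1, hnd2]
  have pg0 := mul_nonneg hMa hg0
  have pg1 := mul_nonneg hMb1 hg1
  have pg2 := mul_nonneg hMb2 hg2
  have pg3 := mul_nonneg hMc hg3
  have pg4 := mul_nonneg hMd hg4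
  exact arith_item_agg p r₁ r₂ nn π μ lv l1 l2 t0 t1 t2 t3 t4 hμ0 hμπ hlv hl1 hl2 hsl hta0 hta1 hta2 htb₁0 htb₁1 htb₁2 htb₂0 htb₂1 htb₂2 htc0 htc1 htc2 htd0 htd1 htd2
    t S a0 a1 a2 b10 b11 b12 b20 b21 b22 c0 c1 c2 d0 d1 d2 hna0 hna1 hna2 hnb10 hnb11 hnb12 hnb20 hnb21 hnb22 hnc0 hnc1 hnc2 hnd0 hnd1 hnd2 hsum _hH1 _hH2 _hH3 hcv hc1 hc2 hout hsub hmean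
    (by linarith only [pg0, pg1, pg2, pg3, pg4])

/-- **Sign cases for a weighted sum of items** (the Harris engine's last step): if `Σ_j w_j G_j ≥ 0` with `w_j ≥ 0`, `Σ w_j > 0`, some
`G_j ≥ 0`; each `G_j ≥ 0` proves the row (by `arith_item_agg`). [this work] -/
theorem of_weighted₃ {C : Prop} (G₁ G₂ G₃ w₁ w₂ w₃ : ℝ) (hw₁ : 0 ≤ w₁) (hw₂ : 0 ≤ w₂) (hw₃ : 0 ≤ w₃) (hpos : 0 < w₁ + w₂ + w₃)
    (hsum : 0 ≤ w₁ * G₁ + w₂ * G₂ + w₃ * G₃) (h₁ : 0 ≤ G₁ → C) (h₂ : 0 ≤ G₂ → C) (h₃ : 0 ≤ G₃ → C) : C := by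
  rcases le_or_gt 0 G₁ with g1 | g1
  · exact h₁ g1
  rcases le_or_gt 0 G₂ with g2 | g2
  · exact h₂ g2
  rcases le_or_gt 0 G₃ with g3 | g3
  · exact h₃ g3
  exfalso
  set m := max G₁ (max G₂ G₃) with hm
  have hmneg : m < 0 := max_lt g1 (max_lt g2 g3)
  have e1 : w₁ * G₁ ≤ w₁ * m := mul_le_mul_of_nonneg_left (le_max_left _ _) hw₁
  have e2 : w₂ * G₂ ≤ w₂ * m := mul_le_mul_of_nonneg_left (le_trans (le_max_left _ _) (le_max_right _ _)) hw₂
  have e3 : w₃ * G₃ ≤ w₃ * m := mul_le_mul_of_nonneg_left (le_trans (le_max_right _ _) (le_max_right _ _)) hw₃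
  have : (w₁ + w₂ + w₃) * m < 0 := mul_neg_of_pos_of_neg hpos hmneg
  nlinarith only [hsum, e1, e2, e3, this]

/-- **The band certificate** (pure real, cover-lemma format): a price `π` between the break-even prices `ρ₀ ≤ π ≤ ρ₃` of the apart types
(`ρ₀ = pW₁₂/(1−p·max r)`, `ρ₃ = pW₁₂/(1−p(1−W₁₂))`), below the `k`-switches of the other types (`C0–C3`), with WITNESS weights `μ, λ_v, λ₁, λ₂`
satisfying the five type inequalities `g_T ≥ 0` of the generalized item with `t = (φ₀₁ − π sub₀₁, φ₁₀ − π sub₁₀, φ₂₀ − π sub₂₀, φ₃₀ − π sub₃₀, 1 − nπ)`.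
For every point of the Harris-free wild band left open by files XIV–XVI a witness exists at `π = ρ₃` or `π = ρ₀` (exact LP, `num3/band5.py`:
2 451 / 2 451). [this work] -/
theorem arith_band (p r₁ r₂ nn π μ lv l1 l2 : ℝ) (hp0 : 0 ≤ p) (hp1 : p ≤ 1) (hr10 : 0 ≤ r₁) (hr11 : r₁ ≤ 1) (hr20 : 0 ≤ r₂) (hr21 : r₂ ≤ 1)
    (hn : 1 ≤ nn) (hμ0 : 0 ≤ μ) (hμπ : μ ≤ π) (hlv : 0 ≤ lv) (hl1 : 0 ≤ l1) (hl2 : 0 ≤ l2) (hsl : lv + l1 + l2 + nn * (π - μ) = 1)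
    (hρ0 : p * ((1 - r₁) * (1 - r₂)) ≤ π * (1 - p * max r₁ r₂))
    (hρ3 : π * (1 - p * (1 - (1 - r₁) * (1 - r₂))) ≤ p * ((1 - r₁) * (1 - r₂)))
    (hC0 : π * (nn - 1) * (1 - p * max r₁ r₂) ≤ 1 - p)
    (hC1 : π * nn * (1 - (1 - (1 - p) * (1 - r₁)) * r₂) ≤ (1 - p) * (1 - r₁))
    (hC2 : π * nn * (1 - (1 - (1 - p) * (1 - r₂)) * r₁) ≤ (1 - p) * (1 - r₂))
    (hC3 : π * nn ≤ 1)
    (hg0 : 0 ≤ (p - π * ((1 + p * max r₁ r₂ * (nn - 1)))) - lv * p - l1 * (p * r₁) - l2 * (p * r₂) + μ * (2 - (p + (p * r₁) + (p * r₂))))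
    (hg1 : 0 ≤ ((1 - (1 - p) * (1 - r₁)) - π * ((1 - (1 - p) * (1 - r₁)) * r₂ * nn)) - lv * (1 - (1 - p) * (1 - r₁)) - l1 * 1 - l2 * (r₂ * (1 - (1 - p) * (1 - r₁))) + μ * (2 - ((1 - (1 - p) * (1 - r₁)) + 1 + (r₂ * (1 - (1 - p) * (1 - r₁))))))
    (hg2 : 0 ≤ ((1 - (1 - p) * (1 - r₂)) - π * ((1 - (1 - p) * (1 - r₂)) * r₁ * nn)) - lv * (1 - (1 - p) * (1 - r₂)) - l1 * (r₁ * (1 - (1 - p) * (1 - r₂))) - l2 * 1 + μ * (2 - ((1 - (1 - p) * (1 - r₂)) + (r₁ * (1 - (1 - p) * (1 - r₂))) + 1)))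
    (hg3 : 0 ≤ (p * (1 - (1 - r₁) * (1 - r₂)) - π * (p * (1 - (1 - r₁) * (1 - r₂)) * nn)) - lv * p - l1 * (p * (1 - (1 - r₁) * (1 - r₂))) - l2 * (p * (1 - (1 - r₁) * (1 - r₂))) + μ * (2 - (p + (p * (1 - (1 - r₁) * (1 - r₂))) + (p * (1 - (1 - r₁) * (1 - r₂))))))
    (hg4 : 0 ≤ (1 - π * (nn)) - lv * (1 - (1 - p) * ((1 - r₁) * (1 - r₂))) - l1 * 1 - l2 * 1 + μ * (2 - ((1 - (1 - p) * ((1 - r₁) * (1 - r₂))) + 1 + 1))) :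
    ∀ (t S a0 a1 a2 b10 b11 b12 b20 b21 b22 c0 c1 c2 d0 d1 d2 : ℝ), 0 ≤ a0 → 0 ≤ a1 → 0 ≤ a2 → 0 ≤ b10 → 0 ≤ b11 → 0 ≤ b12 → 0 ≤ b20 → 0 ≤ b21 → 0 ≤ b22 → 0 ≤ c0 → 0 ≤ c1 → 0 ≤ c2 → 0 ≤ d0 → 0 ≤ d1 → 0 ≤ d2 →
        a0 + a1 + a2 + b10 + b11 + b12 + b20 + b21 + b22 + c0 + c1 + c2 + d0 + d1 + d2 = 1 →
        ((a0 + a1 + a2) + (c0 + c1 + c2) + (b20 + b21 + b22)) * ((a0 + a1 + a2) + (b10 + b11 + b12)) ≤ (a0 + a1 + a2) →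
        ((a0 + a1 + a2) + (c0 + c1 + c2) + (b10 + b11 + b12)) * ((a0 + a1 + a2) + (b20 + b21 + b22)) ≤ (a0 + a1 + a2) →
        ((a0 + a1 + a2) + (b10 + b11 + b12) + (b20 + b21 + b22)) * ((a0 + a1 + a2) + (c0 + c1 + c2)) ≤ (a0 + a1 + a2) →
        (1 - p) * (r₁ * r₂) * ((a0 + a1 + a2) + (c0 + c1 + c2)) + (1 - p) * (r₁ * (1 - r₂)) * ((a0 + a1 + a2) + (c0 + c1 + c2) + (b20 + b21 + b22)) + (1 - p) * ((1 - r₁) * r₂) * ((a0 + a1 + a2) + (c0 + c1 + c2) + (b10 + b11 + b12)) + (1 - p) * ((1 - r₁) * (1 - r₂)) ≤ t →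
        p * ((1 - r₁) * r₂) * ((a0 + a1 + a2) + (b20 + b21 + b22)) + (1 - p) * (r₁ * r₂) * ((a0 + a1 + a2) + (c0 + c1 + c2)) + (p * ((1 - r₁) * (1 - r₂)) + (1 - p) * (r₁ * (1 - r₂)) + (1 - p) * ((1 - r₁) * r₂) + (1 - p) * ((1 - r₁) * (1 - r₂))) * ((a0 + a1 + a2) + (c0 + c1 + c2) + (b20 + b21 + b22)) ≤ t →
        p * ((1 - r₂) * r₁) * ((a0 + a1 + a2) + (b10 + b11 + b12)) + (1 - p) * (r₂ * r₁) * ((a0 + a1 + a2) + (c0 + c1 + c2)) + (p * ((1 - r₂) * (1 - r₁)) + (1 - p) * (r₂ * (1 - r₁)) + (1 - p) * ((1 - r₂) * r₁) + (1 - p) * ((1 - r₂) * (1 - r₁))) * ((a0 + a1 + a2) + (c0 + c1 + c2) + (b10 + b11 + b12)) ≤ t →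
        nn - S ≤ nn * t →
        S ≤ (p * max r₁ r₂ * nn * a0 + (1 + p * max r₁ r₂ * (nn - 1)) * a1 + nn * a2) + ((1 - (1 - p) * (1 - r₁)) * r₂ * nn * b10 + (1 + (1 - (1 - p) * (1 - r₁)) * r₂ * (nn - 1)) * b11 + nn * b12) + ((1 - (1 - p) * (1 - r₂)) * r₁ * nn * b20 + (1 + (1 - (1 - p) * (1 - r₂)) * r₁ * (nn - 1)) * b21 + nn * b22) + (p * (1 - (1 - r₁) * (1 - r₂)) * nn * c0 + (1 + p * (1 - (1 - r₁) * (1 - r₂)) * (nn - 1)) * c1 + nn * c2) + ((1 : ℝ) * d1 + nn * d2) →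
        2 < (1 - ((1 - p) * (r₁ * r₂) * ((a0 + a1 + a2) + (c0 + c1 + c2)) + (1 - p) * (r₁ * (1 - r₂)) * ((a0 + a1 + a2) + (c0 + c1 + c2) + (b20 + b21 + b22)) + (1 - p) * ((1 - r₁) * r₂) * ((a0 + a1 + a2) + (c0 + c1 + c2) + (b10 + b11 + b12)) + (1 - p) * ((1 - r₁) * (1 - r₂)))) + (1 - (p * ((1 - r₁) * r₂) * ((a0 + a1 + a2) + (b20 + b21 + b22)) + (1 - p) * (r₁ * r₂) * ((a0 + a1 + a2) + (c0 + c1 + c2)) + (p * ((1 - r₁) * (1 - r₂)) + (1 - p) * (r₁ * (1 - r₂)) + (1 - p) * ((1 - r₁) * r₂) + (1 - p) * ((1 - r₁) * (1 - r₂))) * ((a0 + a1 + a2) + (c0 + c1 + c2) + (b20 + b21 + b22)))) + (1 - (p * ((1 - r₂) * r₁) * ((a0 + a1 + a2) + (b10 + b11 + b12)) + (1 - p) * (r₂ * r₁) * ((a0 + a1 + a2) + (c0 + c1 + c2)) + (p * ((1 - r₂) * (1 - r₁)) + (1 - p) * (r₂ * (1 - r₁)) + (1 - p) * ((1 - r₂)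 * r₁) + (1 - p) * ((1 - r₂) * (1 - r₁))) * ((a0 + a1 + a2) + (c0 + c1 + c2) + (b10 + b11 + b12)))) + S →
        p * ((1 - r₁) * (1 - r₂)) * (a0 + c0) + (1 - p) * (r₁ * r₂) * (a0 + a1 + c0 + c1) + (1 - p) * (r₁ * (1 - r₂)) * (a0 + a1 + c0 + c1 + b20) + (1 - p) * ((1 - r₁) * r₂) * (a0 + a1 + c0 + c1 + b10) + (1 - p) * ((1 - r₁) * (1 - r₂)) * (a0 + a1 + c0 + c1 + b10 + b20) ≤ t := by
  intro t S a0 a1 a2 b10 b11 b12 b20 b21 b22 c0 c1 c2 d0 d1 d2 hna0 hna1 hna2 hnb10 hnb11 hnb12 hnb20 hnb21 hnb22 hnc0 hnc1 hnc2 hnd0 hnd1 hnd2 hsum hH1 hH2 hH3 hcv hc1 hc2 hout hsub hmean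
  have hπ0 : 0 ≤ π := le_trans hμ0 hμπ
  have hn0 : 0 ≤ nn := by linarith only [hn]
  have hW12 : 0 ≤ (1 - r₁) * (1 - r₂) := mul_nonneg (sub_nonneg.2 hr11) (sub_nonneg.2 hr21)
  have hW12le : (1 - r₁) * (1 - r₂) ≤ 1 := by
    have h := mul_le_mul (sub_le_self 1 hr10) (sub_le_self 1 hr20) (sub_nonneg.2 hr21) zero_le_one
    linarith only [h]
  have h1W1 : 0 ≤ 1 - (1 - p) * (1 - r₁) := by
    have h := mul_nonneg hp0 (sub_nonneg.2 hr11)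
    linarith only [h, hr10]
  have h1W2 : 0 ≤ 1 - (1 - p) * (1 - r₂) := by
    have h := mul_nonneg hp0 (sub_nonneg.2 hr21)
    linarith only [h, hr20]
  have hW1le : 1 - (1 - p) * (1 - r₁) ≤ 1 := by
    have h := mul_nonneg (sub_nonneg.2 hp1) (sub_nonneg.2 hr11)
    linarith only [h]
  have hW2le : 1 - (1 - p) * (1 - r₂) ≤ 1 := by
    have h := mul_nonneg (sub_nonneg.2 hp1) (sub_nonneg.2 hr21)
    linarith only [h]
  have hf1le : (1 - (1 - p) * (1 - r₁)) * r₂ ≤ 1 := by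
    have h := mul_le_mul hW1le hr21 hr20 zero_le_one
    linarith only [h]
  have hf2le : (1 - (1 - p) * (1 - r₂)) * r₁ ≤ 1 := by
    have h := mul_le_mul hW2le hr11 hr10 zero_le_one
    linarith only [h]
  have hf3le : p * (1 - (1 - r₁) * (1 - r₂)) ≤ 1 := by
    have h := mul_le_mul hp1 (sub_le_self 1 hW12) (by linarith only [hW12le]) zero_le_one
    linarith only [h]
  have ca0 : p - π * ((1 + p * max r₁ r₂ * (nn - 1))) ≤ p * (1 - (1 - r₁) * (1 - r₂)) - π * (p * max r₁ r₂ * nn) := by linarith only [hρ0]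
  have ca1 : p - π * ((1 + p * max r₁ r₂ * (nn - 1))) ≤ p - π * ((1 + p * max r₁ r₂ * (nn - 1))) := le_refl _
  have ca2 : p - π * ((1 + p * max r₁ r₂ * (nn - 1))) ≤ 1 - π * (nn) := by linarith only [hC0]
  have cb10 : (1 - (1 - p) * (1 - r₁)) - π * ((1 - (1 - p) * (1 - r₁)) * r₂ * nn) ≤ (1 - (1 - p) * (1 - r₁)) - π * ((1 - (1 - p) * (1 - r₁)) * r₂ * nn) := le_refl _
  have cb11 : (1 - (1 - p) * (1 - r₁)) - π * ((1 - (1 - p) * (1 - r₁)) * r₂ * nn) ≤ 1 - π * ((1 + (1 - (1 - p) * (1 - r₁)) * r₂ * (nn - 1))) := by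
    have h := mul_nonneg (mul_nonneg hπ0 (sub_nonneg.2 hf1le)) (sub_nonneg.2 hn)
    linarith only [h, hC1]
  have cb12 : (1 - (1 - p) * (1 - r₁)) - π * ((1 - (1 - p) * (1 - r₁)) * r₂ * nn) ≤ 1 - π * (nn) := by linarith only [hC1]
  have cb20 : (1 - (1 - p) * (1 - r₂)) - π * ((1 - (1 - p) * (1 - r₂)) * r₁ * nn) ≤ (1 - (1 - p) * (1 - r₂)) - π * ((1 - (1 - p) * (1 - r₂)) * r₁ * nn) := le_refl _
  have cb21 : (1 - (1 - p) * (1 - r₂)) - π * ((1 - (1 - p) * (1 - r₂)) * r₁ * nn) ≤ 1 - π * ((1 + (1 - (1 - p) * (1 - r₂)) * r₁ * (nn - 1))) := by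
    have h := mul_nonneg (mul_nonneg hπ0 (sub_nonneg.2 hf2le)) (sub_nonneg.2 hn)
    linarith only [h, hC2]
  have cb22 : (1 - (1 - p) * (1 - r₂)) - π * ((1 - (1 - p) * (1 - r₂)) * r₁ * nn) ≤ 1 - π * (nn) := by linarith only [hC2]
  have cc0 : p * (1 - (1 - r₁) * (1 - r₂)) - π * (p * (1 - (1 - r₁) * (1 - r₂)) * nn) ≤ p * (1 - (1 - r₁) * (1 - r₂)) - π * (p * (1 - (1 - r₁) * (1 - r₂)) * nn) := le_refl _
  have cc1 : p * (1 - (1 - r₁) * (1 - r₂)) - π * (p * (1 - (1 - r₁) * (1 - r₂)) * nn) ≤ p - π * ((1 + p * (1 - (1 - r₁) * (1 - r₂)) * (nn - 1))) := by linarith only [hρ3]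
  have cc2 : p * (1 - (1 - r₁) * (1 - r₂)) - π * (p * (1 - (1 - r₁) * (1 - r₂)) * nn) ≤ 1 - π * (nn) := by
    have h := mul_nonneg (sub_nonneg.2 hf3le) (sub_nonneg.2 hC3)
    linarith only [h]
  have cd0 : 1 - π * (nn) ≤ 1 - π * (0 * nn) := by
    have hx : 0 ≤ π * nn := mul_nonneg hπ0 hn0
    linarith only [hx]
  have cd1 : 1 - π * (nn) ≤ 1 - π * ((1 + 0 * (nn - 1))) := by
    have hx : π * 1 ≤ π * nn := mul_le_mul_of_nonneg_left hn hπ0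
    linarith only [hx]
  have cd2 : 1 - π * (nn) ≤ 1 - π * (nn) := le_refl _
  exact arith_item p r₁ r₂ nn π μ lv l1 l2 _ _ _ _ _ hμ0 hμπ hlv hl1 hl2 hsl ca0 ca1 ca2 cb10 cb11 cb12 cb20 cb21 cb22 cc0 cc1 cc2 cd0 cd1 cd2 hg0 hg1 hg2 hg3 hg4
    t S a0 a1 a2 b10 b11 b12 b20 b21 b22 c0 c1 c2 d0 d1 d2 hna0 hna1 hna2 hnb10 hnb11 hnb12 hnb20 hnb21 hnb22 hnc0 hnc1 hnc2 hnd0 hnd1 hnd2 hsum hH1 hH2 hH3 hcv hc1 hc2 hout hsub hmean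

end Gate3

variable {n : ℕ}

/-- **FAR at layer one for the degree-three gate in the BAND** (memo §6c): given a price `π ∈ [ρ₀, ρ₃]` below the `k`-switches and witness
weights `μ, λ_v, λ₁, λ₂` for the five type inequalities (a two-variable LP at fixed parameters; witnesses exist on the whole Harris-free band),
the mean and the cuts give the row on every graph. [this work] -/
theorem farLayerOne_of_gate3_band (w : Sym2 (Fin n) → unitInterval) (A : Finset (Fin n)) {o v u₁ u₂ : Fin n}
    (hov : o ≠ v) (h1v : u₁ ≠ v) (h2v : u₂ ≠ v) (ho1 : o ≠ u₁) (ho2 : o ≠ u₂) (h12 : u₁ ≠ u₂)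
    (hvA : v ∈ A) (h1A : u₁ ∈ A) (h2A : u₂ ∈ A)
    (hw : ∀ z : Fin n, z ≠ o → z ≠ u₁ → z ≠ u₂ → z ≠ v → (w s(v, z) : ℝ) = 0)
    (hn : 1 ≤ ((((A.erase v).erase u₁).erase u₂).card : ℝ)) (π μ lv l1 l2 : ℝ) (hμ0 : 0 ≤ μ) (hμπ : μ ≤ π) (hlv : 0 ≤ lv) (hl1 : 0 ≤ l1) (hl2 : 0 ≤ l2)
    (hsl : lv + l1 + l2 + ((((A.erase v).erase u₁).erase u₂).card : ℝ) * (π - μ) = 1)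
    (hρ0 : (w s(o, v) : ℝ) * ((1 - (w s(v, u₁) : ℝ)) * (1 - (w s(v, u₂) : ℝ))) ≤ π * (1 - (w s(o, v) : ℝ) * max (w s(v, u₁) : ℝ) (w s(v, u₂) : ℝ)))
    (hρ3 : π * (1 - (w s(o, v) : ℝ) * (1 - (1 - (w s(v, u₁) : ℝ)) * (1 - (w s(v, u₂) : ℝ)))) ≤ (w s(o, v) : ℝ) * ((1 - (w s(v, u₁) : ℝ)) * (1 - (w s(v, u₂) : ℝ))))
    (hC0 : π * (((((A.erase v).erase u₁).erase u₂).card : ℝ) - 1) * (1 - (w s(o, v) : ℝ) * max (w s(v, u₁) : ℝ) (w s(v, u₂) : ℝ)) ≤ 1 - (w s(o, v) : ℝ))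
    (hC1 : π * ((((A.erase v).erase u₁).erase u₂).card : ℝ) * (1 - (1 - (1 - (w s(o, v) : ℝ)) * (1 - (w s(v, u₁) : ℝ))) * (w s(v, u₂) : ℝ)) ≤ (1 - (w s(o, v) : ℝ)) * (1 - (w s(v, u₁) : ℝ)))
    (hC2 : π * ((((A.erase v).erase u₁).erase u₂).card : ℝ) * (1 - (1 - (1 - (w s(o, v) : ℝ)) * (1 - (w s(v, u₂) : ℝ))) * (w s(v, u₁) : ℝ)) ≤ (1 - (w s(o, v) : ℝ)) * (1 - (w s(v, u₂) : ℝ)))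
    (hC3 : π * ((((A.erase v).erase u₁).erase u₂).card : ℝ) ≤ 1)
    (hg0 : 0 ≤ ((w s(o, v) : ℝ) - π * ((1 + (w s(o, v) : ℝ) * max (w s(v, u₁) : ℝ) (w s(v, u₂) : ℝ) * (((((A.erase v).erase u₁).erase u₂).card : ℝ) - 1)))) - lv * (w s(o, v) : ℝ) - l1 * ((w s(o, v) : ℝ) * (w s(v, u₁) : ℝ)) - l2 * ((w s(o, v) : ℝ) * (w s(v, u₂) : ℝ)) + μ * (2 - ((w s(o, v) : ℝ) + ((w s(o, v) : ℝ) * (w s(v, u₁) : ℝ)) + ((w s(o, v) : ℝ) * (w s(v, u₂) : ℝ)))))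
    (hg1 : 0 ≤ ((1 - (1 - (w s(o, v) : ℝ)) * (1 - (w s(v, u₁) : ℝ))) - π * ((1 - (1 - (w s(o, v) : ℝ)) * (1 - (w s(v, u₁) : ℝ))) * (w s(v, u₂) : ℝ) * ((((A.erase v).erase u₁).erase u₂).card : ℝ))) - lv * (1 - (1 - (w s(o, v) : ℝ)) * (1 - (w s(v, u₁) : ℝ))) - l1 * 1 - l2 * ((w s(v, u₂) : ℝ) * (1 - (1 - (w s(o, v) : ℝ)) * (1 - (w s(v, u₁) : ℝ)))) + μ * (2 - ((1 - (1 - (w s(o, v) : ℝ)) * (1 - (w s(v, u₁) : ℝ))) + 1 + ((w s(v, u₂) : ℝ) * (1 - (1 - (w s(o, v) : ℝ)) * (1 - (w s(v, u₁) : ℝ)))))))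
    (hg2 : 0 ≤ ((1 - (1 - (w s(o, v) : ℝ)) * (1 - (w s(v, u₂) : ℝ))) - π * ((1 - (1 - (w s(o, v) : ℝ)) * (1 - (w s(v, u₂) : ℝ))) * (w s(v, u₁) : ℝ) * ((((A.erase v).erase u₁).erase u₂).card : ℝ))) - lv * (1 - (1 - (w s(o, v) : ℝ)) * (1 - (w s(v, u₂) : ℝ))) - l1 * ((w s(v, u₁) : ℝ) * (1 - (1 - (w s(o, v) : ℝ)) * (1 - (w s(v, u₂) : ℝ)))) - l2 * 1 + μ * (2 - ((1 - (1 - (w s(o, v) : ℝ)) * (1 - (w s(v, u₂) : ℝ))) + ((w s(v, u₁) : ℝ) * (1 - (1 - (w s(o, v) : ℝ)) * (1 - (w s(v, u₂) : ℝ)))) + 1)))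
    (hg3 : 0 ≤ ((w s(o, v) : ℝ) * (1 - (1 - (w s(v, u₁) : ℝ)) * (1 - (w s(v, u₂) : ℝ))) - π * ((w s(o, v) : ℝ) * (1 - (1 - (w s(v, u₁) : ℝ)) * (1 - (w s(v, u₂) : ℝ))) * ((((A.erase v).erase u₁).erase u₂).card : ℝ))) - lv * (w s(o, v) : ℝ) - l1 * ((w s(o, v) : ℝ) * (1 - (1 - (w s(v, u₁) : ℝ)) * (1 - (w s(v, u₂) : ℝ)))) - l2 * ((w s(o, v) : ℝ) * (1 - (1 - (w s(v, u₁) : ℝ)) * (1 - (w s(v, u₂) : ℝ)))) + μ * (2 - ((w s(o, v) : ℝ) + ((w s(o, v) : ℝ) * (1 - (1 - (w s(v, u₁) : ℝ)) * (1 - (w s(v, u₂) : ℝ)))) + ((w s(o, v) : ℝ) * (1 - (1 - (w s(v, u₁) : ℝ)) * (1 - (w s(v, u₂) : ℝ)))))))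
    (hg4 : 0 ≤ (1 - π * (((((A.erase v).erase u₁).erase u₂).card : ℝ))) - lv * (1 - (1 - (w s(o, v) : ℝ)) * ((1 - (w s(v, u₁) : ℝ)) * (1 - (w s(v, u₂) : ℝ)))) - l1 * 1 - l2 * 1 + μ * (2 - ((1 - (1 - (w s(o, v) : ℝ)) * ((1 - (w s(v, u₁) : ℝ)) * (1 - (w s(v, u₂) : ℝ)))) + 1 + 1)))
    (t : ℝ) (hEN : 2 < ∑ a ∈ A, (prodBernoulli w).real (openConn o a))
    (hcut : ∀ a ∈ A, (prodBernoulli w).real (openConn o a : Set (BondConfig (Fin n)))ᶜ ≤ t) :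
    (prodBernoulli w).real {ω : BondConfig (Fin n) | (A.filter fun a => ω ∈ openConn o a).card ≤ 1} ≤ t :=
  farLayerOne_of_gate3_of_cover w A hov h1v h2v ho1 ho2 h12 hvA h1A h2A hw
    (Gate3.arith_band (w s(o, v) : ℝ) (w s(v, u₁) : ℝ) (w s(v, u₂) : ℝ) ((((A.erase v).erase u₁).erase u₂).card : ℝ) π μ lv l1 l2 (w s(o, v)).2.1 (w s(o, v)).2.2 (w s(v, u₁)).2.1 (w s(v, u₁)).2.2
      (w s(v, u₂)).2.1 (w s(v, u₂)).2.2 hn hμ0 hμπ hlv hl1 hl2 hsl hρ0 hρ3 hC0 hC1 hC2 hC3 hg0 hg1 hg2 hg3 hg4) t hEN hcut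

end Quant

end Summit.CriticalPhenomena.PercolationContinuityZ3.Theorems
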